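/-
Origin: expansion seat `planner-pub-hodgecm-pv02-g3-0`, handover #14 2026-08-18T06:32:59Z (`HOME/pub-hodgecm-pv02-g3/lean/Pv02g3/PerL34/OrbitGlue.lean`, md5 e8c9b5d2, 185 lines);
landed by the gen-7 packager in gate run 25 as `HodgeCM/PerL34/OrbitGlue.lean` (import ^import Pv[0-9]+g[0-9]+\.PerL34\.→import HodgeCM.PerL34. ×3; stripped 1 #print/#check/#eval lines).
-/
/-
Origin: planner-pub-hodgecm-pv02-g3-0 (unit pub-hodgecm-pv02-g3, DAG-NODE PROVER #02 gen 3), 2026-08-18.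
Proposed tree path: `HodgeCM/PerL34/OrbitGlue.lean` (new, additive).  Imports my run-24 files `SplitHolFormulas`,
`LineClass`, `WedgeAlgebra` (tree names after landing).  KERNEL: nothing cited, nothing asserted.
-/
import Summits.HodgeConjecture.HodgeCM.PerL34.SplitHolFormulas
import Summits.HodgeConjecture.HodgeCM.PerL34.LineClass
import Summits.HodgeConjecture.HodgeCM.PerL34.WedgeAlgebra

/-!
# `OrbitSpansDisjoint` reduced to the vanishing of the class numerators (steps K0, K2, K3 of the blueprint)

`orbitSpansDisjoint_of_classVanishing`: if for every pair of finite coefficient families `a, b` on `U(2,1)` with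
`Σ a_s·push s dz0 = Σ b_s·push s ω₀` on the ball every CLASS NUMERATOR
`Q v x j = Σ_{s ∈ S, cl s = v} (s₂₂)⁻² (a_s DZ_s − b_s OM_s)(x)_j` vanishes (`ClassVanishing`, the partial-fraction
step K1 of `HOME/pub-hodgecm-pv02-g3/HANDOFF.md`), then `orbitSpan dz0 ⊓ orbitSpan omega0 = ⊥`.
-/

noncomputable section

open Matrix

namespace HodgeCM
namespace PerL34
namespace SplitHolForms

open HodgeCM.PerL34.BallModel HodgeCM.PerL34.BallSpans HodgeCM.PerL34.LineClass HodgeCM.PerL34.WedgeAlgebra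

/-- `dz₀`-numerator. -/
def DZ (s : U21) (x : Ball) (j : Fin 2) : ℂ :=
  mat s 0 (Fin.castSucc j) * W3 s x 2 - W3 s x 0 * mat s 2 (Fin.castSucc j)

/-- `ω₀`-numerator. -/
def OM (s : U21) (x : Ball) (j : Fin 2) : ℂ :=
  W3 s x 0 * mat s 1 (Fin.castSucc j) - W3 s x 1 * mat s 0 (Fin.castSucc j)

/-- (Ported verbatim from the HodgeCMPerL package; no docstring in the source.) -/
theorem push_dz0_eq (s : U21) (x : Ball) (j : Fin 2) : push s dz0 x j = DZ s x j / W3 s x 2 ^ 2 :=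
  push_dz0_apply s x j

/-- (Ported verbatim from the HodgeCMPerL package; no docstring in the source.) -/
theorem push_omega0_eq (s : U21) (x : Ball) (j : Fin 2) : push s omega0 x j = OM s x j / W3 s x 2 ^ 2 :=
  push_omega0_apply s x j

/-- The line classifier: the pole line `ℓ_s = 0` normalised by `s₂₂ ≠ 0`. -/
def cl (s : U21) : ℂ × ℂ := (mat s 2 0 / mat s 2 2, mat s 2 1 / mat s 2 2)

/-- The ratio of the last rows inside a class. -/
def cr (s₁ s : U21) : ℂ := mat s 2 2 / mat s₁ 2 2

/-- (Ported verbatim from the HodgeCMPerL package; no docstring in the source.) -/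
theorem cr_ne_zero (s₁ s : U21) : cr s₁ s ≠ 0 := div_ne_zero (mat_22_ne_zero s) (mat_22_ne_zero s₁)

/-- (Ported verbatim from the HodgeCMPerL package; no docstring in the source.) -/
theorem row_of_cl_eq {s₁ s : U21} (h : cl s = cl s₁) (j : Fin 3) : mat s 2 j = cr s₁ s * mat s₁ 2 j := by
  have h1 := mat_22_ne_zero s
  have h2 := mat_22_ne_zero s₁
  simp only [cl, Prod.mk.injEq] at h
  obtain ⟨ha, hb⟩ := h
  rw [div_eq_div_iff h1 h2] at ha hb
  fin_cases j
  · simp only [cr, Fin.zero_eta]; field_simp; linear_combination ha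
  · simp only [cr, Fin.mk_one]; field_simp; linear_combination hb
  · simp only [cr, Fin.reduceFinMk]; field_simp

/-- (Ported verbatim from the HodgeCMPerL package; no docstring in the source.) -/
theorem W3_2_of_cl_eq {s₁ s : U21} (h : cl s = cl s₁) (x : Ball) : W3 s x 2 = cr s₁ s * W3 s₁ x 2 := by
  simp only [W3_apply, row_of_cl_eq h]
  ring

/-- The proportionality factor of the `ω₀`-numerators inside a class (`LineClass.omegaNum_sameClass`). -/
def μ (s₁ s : U21) (h : cl s = cl s₁) : ℂ :=
  Classical.choose (omegaNum_sameClass s₁ s (cr s₁ s) (row_of_cl_eq h))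

/-- (Ported verbatim from the HodgeCMPerL package; no docstring in the source.) -/
theorem OM_of_cl_eq {s₁ s : U21} (h : cl s = cl s₁) (x : Ball) (j : Fin 2) : OM s x j = μ s₁ s h * OM s₁ x j :=
  Classical.choose_spec (omegaNum_sameClass s₁ s (cr s₁ s) (row_of_cl_eq h)) x j

/-- (Ported verbatim from the HodgeCMPerL package; no docstring in the source.) -/
theorem DZ_of_cl_eq {s₁ s : U21} (h : cl s = cl s₁) (x : Ball) (j : Fin 2) :
    DZ s x j = cr s₁ s * (W3 s₁ x 2 * mat s 0 (Fin.castSucc j) - W3 s x 0 * mat s₁ 2 (Fin.castSucc j)) :=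
  dzNum_sameClass s₁ s (cr s₁ s) (row_of_cl_eq h) x j

/-- The class numerator of a pair of coefficient families. -/
def Q (S : Finset U21) (a b : U21 → ℂ) (v : ℂ × ℂ) (x : Ball) (j : Fin 2) : ℂ :=
  ∑ s ∈ S.filter (fun s => cl s = v), (mat s 2 2)⁻¹ ^ 2 * (a s * DZ s x j - b s * OM s x j)

/-- **K1 as a hypothesis**: every class numerator of every balanced pair vanishes. -/
def ClassVanishing : Prop :=
  ∀ (S : Finset U21) (a b : U21 → ℂ),
    (∀ (x : Ball) (j : Fin 2), ∑ s ∈ S, (a s * DZ s x j - b s * OM s x j) / W3 s x 2 ^ 2 = 0) →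
      ∀ (v : ℂ × ℂ) (x : Ball) (j : Fin 2), Q S a b v x j = 0

/-- **K2**: inside one class, vanishing of the class numerator kills the `ω₀`-part. -/
theorem class_omega_zero (S : Finset U21) (a b : U21 → ℂ) (s₁ : U21)
    (hQ : ∀ (x : Ball) (j : Fin 2), Q S a b (cl s₁) x j = 0) (x : Ball) (j : Fin 2) :
    ∑ s ∈ S.filter (fun s => cl s = cl s₁), b s * OM s x j / W3 s x 2 ^ 2 = 0 := by
  classical
  set F := S.filter (fun s => cl s = cl s₁) with hF
  have hmem : ∀ s ∈ F, cl s = cl s₁ := fun s hs => (Finset.mem_filter.mp hs).2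
  -- weights
  let wa : U21 → ℂ := fun s => (mat s 2 2)⁻¹ ^ 2 * a s * cr s₁ s
  let wb : U21 → ℂ := fun s => if h : cl s = cl s₁ then (mat s 2 2)⁻¹ ^ 2 * b s * μ s₁ s h else 0
  let L : Fin 3 → ℂ := fun m => ∑ s ∈ F, wa s * mat s 0 m
  let β : ℂ := ∑ s ∈ F, wb s
  -- the class numerator in wedge form
  have hwedge : ∀ (y : Ball) (i : Fin 2),
      W3 s₁ y 2 * L (Fin.castSucc i) - (L 0 * y.1 0 + L 1 * y.1 1 + L 2) * mat s₁ 2 (Fin.castSucc i) =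
        β * (W3 s₁ y 0 * mat s₁ 1 (Fin.castSucc i) - W3 s₁ y 1 * mat s₁ 0 (Fin.castSucc i)) := by
    intro y i
    have hq := hQ y i
    have hexp : Q S a b (cl s₁) y i =
        ∑ s ∈ F, (wa s * (W3 s₁ y 2 * mat s 0 (Fin.castSucc i) - W3 s y 0 * mat s₁ 2 (Fin.castSucc i)) -
          wb s * OM s₁ y i) := by
      rw [Q, ← hF]
      refine Finset.sum_congr rfl fun s hs => ?_
      have h := hmem s hs
      simp only [wa, wb, dif_pos h]
      rw [DZ_of_cl_eq h, OM_of_cl_eq h]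
      ring
    rw [hexp, Finset.sum_sub_distrib] at hq
    have hL : ∑ s ∈ F, wa s * (W3 s₁ y 2 * mat s 0 (Fin.castSucc i) - W3 s y 0 * mat s₁ 2 (Fin.castSucc i)) =
        W3 s₁ y 2 * L (Fin.castSucc i) - (L 0 * y.1 0 + L 1 * y.1 1 + L 2) * mat s₁ 2 (Fin.castSucc i) := by
      simp only [L, W3_apply, Finset.mul_sum, Finset.sum_mul, ← Finset.sum_sub_distrib, ← Finset.sum_add_distrib]
      refine Finset.sum_congr rfl fun s _ => ?_
      ring
    have hβ : ∑ s ∈ F, wb s * OM s₁ y i =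
        β * (W3 s₁ y 0 * mat s₁ 1 (Fin.castSucc i) - W3 s₁ y 1 * mat s₁ 0 (Fin.castSucc i)) := by
      rw [Finset.sum_mul]
      rfl
    rw [hL, hβ] at hq
    exact sub_eq_zero.mp hq
  have hβ0 : β = 0 := wedge_on_ball s₁ L β hwedge
  -- the ω₀-part of the class is `(s₁)₂₂² β · OM s₁ / W3 s₁ 2²`
  have hsum : ∑ s ∈ F, b s * OM s x j / W3 s x 2 ^ 2 =
      ∑ s ∈ F, wb s * (mat s₁ 2 2 ^ 2 * OM s₁ x j / W3 s₁ x 2 ^ 2) := by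
    refine Finset.sum_congr rfl fun s hs => ?_
    have h := hmem s hs
    have h22 := mat_22_ne_zero s
    have h22' := mat_22_ne_zero s₁
    have hW := W3_2_ne_zero s₁ x
    simp only [wb, dif_pos h]
    rw [OM_of_cl_eq h, W3_2_of_cl_eq h, cr]
    field_simp
  rw [hsum, ← Finset.sum_mul]
  change β * _ = 0
  rw [hβ0, zero_mul]

/-- **K0 + K3**: the reduction. -/
theorem orbitSpansDisjoint_of_classVanishing (H : ClassVanishing) : OrbitSpansDisjoint := by
  classical
  rw [OrbitSpansDisjoint, Submodule.eq_bot_iff]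
  intro θ hθ
  obtain ⟨h0, h1⟩ := Submodule.mem_inf.mp hθ
  obtain ⟨a, ha⟩ := (Finsupp.mem_span_range_iff_exists_finsupp).mp h0
  obtain ⟨b, hb⟩ := (Finsupp.mem_span_range_iff_exists_finsupp).mp h1
  set S : Finset U21 := a.support ∪ b.support with hS
  -- pointwise forms of the two representations, extended to `S`
  have hθa : ∀ (x : Ball) (j : Fin 2), θ x j = ∑ s ∈ S, a s * DZ s x j / W3 s x 2 ^ 2 := by
    intro x j
    rw [← ha, Finsupp.sum_of_support_subset a Finset.subset_union_left _ (fun s _ => by simp)]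
    simp only [Finset.sum_apply, Pi.smul_apply, smul_eq_mul, push_dz0_eq]
    refine Finset.sum_congr rfl fun s _ => ?_
    ring
  have hθb : ∀ (x : Ball) (j : Fin 2), θ x j = ∑ s ∈ S, b s * OM s x j / W3 s x 2 ^ 2 := by
    intro x j
    rw [← hb, Finsupp.sum_of_support_subset b Finset.subset_union_right _ (fun s _ => by simp)]
    simp only [Finset.sum_apply, Pi.smul_apply, smul_eq_mul, push_omega0_eq]
    refine Finset.sum_congr rfl fun s _ => ?_
    ring
  -- K0
  have hK0 : ∀ (x : Ball) (j : Fin 2), ∑ s ∈ S, (a s * DZ s x j - b s * OM s x j) / W3 s x 2 ^ 2 = 0 := by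
    intro x j
    have := (hθa x j).symm.trans (hθb x j)
    simp only [sub_div, Finset.sum_sub_distrib]
    exact sub_eq_zero.mpr this
  have hQ := H S a b hK0
  -- K3: regroup the `ω₀`-representation by classes
  funext x j
  rw [hθb x j, Pi.zero_apply, Pi.zero_apply,
    ← Finset.sum_fiberwise_of_maps_to (g := cl) (t := S.image cl) (fun s hs => Finset.mem_image_of_mem cl hs)]
  refine Finset.sum_eq_zero fun v hv => ?_
  obtain ⟨s₁, hs₁, rfl⟩ := Finset.mem_image.mp hv
  exact class_omega_zero S a b s₁ (fun y i => hQ (cl s₁) y i) x j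

end SplitHolForms
end PerL34
end HodgeCM

end

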